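import Literature.AlgebraicGeometry.Resolution.VPreparedLabelShear
import Literature.AlgebraicGeometry.Resolution.PointStepPrepared
import HarnessLib

/-!
# The RATIONAL `u₁`-chart point step `(1 : a)` with re-preparation: T1-shear ∘ point-step law

OURS (res-inputs-p-8b g2; brick A-iv-pt of PHASE A of the T1 line, memo `plan/inputs/PHASE-A-MEMO-p8b-v0.md`). At a POINT step of the
`τ = 1` line whose near point `x′` is the rational point `(1 : ā)` of the line `L_x` (case (i)/(ii) of the point-step trichotomy
`IsBlowup.pointStep_trichotomy_of_stalkTau_eq_one`: chart data `c′` with `c′₁ = φ u₁`, `φ y = φ u₁ · c′₀`, `φ (u₂ − a u₁) = φ u₁ · c′₂`), a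
`v`-prepared adapted label `c = (y, u₁, u₂)` at `x` is first SHEARED (`exists_prepared_label_shear`, `u₂ ↦ u₂ − a u₁`, `y ↦ z ≡ y mod 𝔪²`;
`α, β` unchanged — Cossart–Jannsen–Saito Lemma 13.6) and then pushed through the ORIGIN point-step law `exists_prepared_label_pointStep`
(CJS Lemma 13.2): the result is a `v`- and `w⁻`-prepared adapted label `cs` at `x′` with `cs₁ = φ u₁` and `βs′ ≤ βs`. The only new
computation is the adapter «`z ≡ y mod 𝔪²` ⇒ `φ z = φ u₁ · (c′₀ + φ u₁ · r)`» (in the `u₁`-chart `𝔪 𝒪′ = (φ u₁)`). No new definitions.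
F-71 / resolution in dim ≥ 4 or char p NOT proved here.
-/

noncomputable section

open IsLocalRing MvPolynomial

namespace Literature.AlgebraicGeometry.Resolution

universe u

variable {R R' : Type u} [CommRing R] [CommRing R'] [IsRegularLocalRing R] [IsRegularLocalRing R']

set_option maxHeartbeats 800000 in
/-- **The rational `u₁`-chart point step with shear and re-preparation** (`β′ ≤ β`, the exceptional parameter stays `φ u₁`).
Input at `x`: `c = (y, u₁, u₂)` generating `𝔪`, `J ⊆ 𝔪^μ` of order exactly `μ`, Newton points, `L < δs` (adapted), `v`-prepared; the
chart data of case (i)/(ii) (`h₁ h₀ h₂`, `hgen′`, residue field onto, `J′` = the colon by `(φ u₁)^μ`, `J′ ⊆ 𝔪′^μ`), and `τ = 1` at `x′` in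
every regular system of parameters. Output at `x′`: `cs` with `cs₁ = φ u₁`, generating `𝔪′`, Newton points, `L < δs′`, `v`- and `w⁻`-prepared,
`J′` of order exactly `μ`, `βs′ ≤ βs`. [cite: CossartJannsenSaito2020, Lemma 13.2 (1)–(2), Lemma 13.6] [cite: CossartPiltant2008, Lemma 4.5 (2), p. 12] -/
theorem exists_prepared_label_pointStep_sheared (φ : R →+* R') [IsLocalHom φ] {c : Fin 3 → R}
    (hgen : Ideal.span {c 0, c 1, c 2} = maximalIdeal R) (hdim : ringKrullDim R = 3) (hdim' : ringKrullDim R' = 3)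
    {J : Ideal R} {μ : ℕ} (hJμ : J ≤ maximalIdeal R ^ μ) (hord : ∃ g ∈ J, g ∉ maximalIdeal R ^ (μ + 1))
    (hne : (pts c J μ).Nonempty) (hδ : μ.factorial < deltaS c J μ) (hvprep : VPrepared c J μ)
    {a : R} {c' : Fin 3 → R'} (h₁ : c' 1 = φ (c 1)) (h₀ : φ (c 0) = φ (c 1) * c' 0)
    (h₂ : φ (c 2 - a * c 1) = φ (c 1) * c' 2) (hgen' : Ideal.span {c' 0, c' 1, c' 2} = maximalIdeal R')
    (hψ : Function.Surjective (ResidueField.map φ))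
    {J' : Ideal R'} (hJ'def : J' = Submodule.colon (Ideal.map φ J) ({φ (c 1) ^ μ} : Set R'))
    (hJμ' : J' ≤ maximalIdeal R' ^ μ)
    (hτ' : ∀ d : Fin 3 → R', Ideal.span {d 0, d 1, d 2} = maximalIdeal R' → hironakaTauAt d J' μ = 1) :
    ∃ cs : Fin 3 → R', cs 1 = φ (c 1) ∧ Ideal.span {cs 0, cs 1, cs 2} = maximalIdeal R' ∧ (pts cs J' μ).Nonempty ∧
      μ.factorial < deltaS cs J' μ ∧ VPrepared cs J' μ ∧ WMinusPrepared cs J' μ ∧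
      (∃ g ∈ J', g ∉ maximalIdeal R' ^ (μ + 1)) ∧ betaS cs J' μ ≤ betaS c J μ := by
  classical
  -- the shear `u₂ ↦ u₂ − a u₁` with re-preparation at `x`
  obtain ⟨z, hz, hgenz, hnez, -, hβz, hδz, -, hwprepz⟩ :=
    exists_prepared_label_shear c hgen hdim (-a) hJμ hne hδ hvprep
  set cz : Fin 3 → R := ![z, c 1, c 2 + -a * c 1] with hcz
  have hcz0 : cz 0 = z := rfl
  have hcz1 : cz 1 = c 1 := rfl
  have hcz2 : cz 2 = c 2 + -a * c 1 := rfl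
  have hgenz' : Ideal.span {cz 0, cz 1, cz 2} = maximalIdeal R := by rw [hcz0, hcz1, hcz2]; exact hgenz
  -- in the `u₁`-chart `𝔪 𝒪′ = (φ u₁)`
  have hmap : (maximalIdeal R).map φ ≤ Ideal.span {φ (c 1)} := by
    rw [← hgen, Ideal.map_span, Ideal.span_le]
    rintro _ ⟨r, hr, rfl⟩
    simp only [Set.mem_insert_iff, Set.mem_singleton_iff] at hr
    rcases hr with rfl | rfl | rfl
    · rw [h₀]; exact Ideal.mul_mem_right _ _ (Ideal.mem_span_singleton_self _)
    · exact Ideal.mem_span_singleton_self _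
    · have e : φ (c 2) = φ (c 2 - a * c 1) + φ a * φ (c 1) := by rw [map_sub, map_mul]; ring
      rw [e, h₂]
      exact Ideal.add_mem _ (Ideal.mul_mem_right _ _ (Ideal.mem_span_singleton_self _))
        (Ideal.mul_mem_left _ _ (Ideal.mem_span_singleton_self _))
  -- the adapter: `φ z = φ u₁ · (c′₀ + φ u₁ · r)`
  have hφq : φ (z - c 0) ∈ Ideal.span {φ (c 1) ^ 2} := by
    have h1 : φ (z - c 0) ∈ ((maximalIdeal R) ^ 2).map φ := Ideal.mem_map_of_mem φ hz
    rw [Ideal.map_pow] at h1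
    have h2 : ((maximalIdeal R).map φ) ^ 2 ≤ Ideal.span {φ (c 1)} ^ 2 := Ideal.pow_right_mono hmap 2
    rw [Ideal.span_singleton_pow] at h2
    exact h2 h1
  obtain ⟨r, hr⟩ := Ideal.mem_span_singleton'.mp hφq
  set c'' : Fin 3 → R' := ![c' 0 + φ (c 1) * r, c' 1, c' 2] with hc''
  have hc''0 : c'' 0 = c' 0 + φ (c 1) * r := rfl
  have hc''1 : c'' 1 = c' 1 := rfl
  have hc''2 : c'' 2 = c' 2 := rfl
  have k₁ : c'' 1 = φ (cz 1) := by rw [hc''1, hcz1, h₁]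
  have k₀ : φ (cz 0) = φ (cz 1) * c'' 0 := by
    rw [hcz0, hcz1, hc''0]
    have : z = c 0 + (z - c 0) := by ring
    rw [this, map_add, h₀, ← hr]; ring
  have k₂ : φ (cz 2) = φ (cz 1) * c'' 2 := by
    rw [hcz2, hcz1, hc''2, ← h₂]; congr 1; ring
  have hgen'' : Ideal.span {c'' 0, c'' 1, c'' 2} = maximalIdeal R' := by
    rw [hc''0, hc''1, hc''2, ← hgen']
    apply le_antisymm
    · rw [Ideal.span_le]
      rintro t ht
      simp only [Set.mem_insert_iff, Set.mem_singleton_iff] at ht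
      rcases ht with rfl | rfl | rfl
      · refine Ideal.add_mem _ (Ideal.subset_span (by simp)) ?_
        rw [← h₁]; exact Ideal.mul_mem_right _ _ (Ideal.subset_span (by simp))
      · exact Ideal.subset_span (by simp)
      · exact Ideal.subset_span (by simp)
    · rw [Ideal.span_le]
      rintro t ht
      simp only [Set.mem_insert_iff, Set.mem_singleton_iff] at ht
      rcases ht with rfl | rfl | rfl
      · have e : c' 0 = (c' 0 + φ (c 1) * r) - φ (c 1) * r := by ring
        rw [e]
        refine Ideal.sub_mem _ (Ideal.subset_span (by simp)) ?_
        rw [← h₁]; exact Ideal.mul_mem_right _ _ (Ideal.subset_span (by simp))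
      · exact Ideal.subset_span (by simp)
      · exact Ideal.subset_span (by simp)
  have hJ'def' : J' = Submodule.colon (Ideal.map φ J) ({φ (cz 1) ^ μ} : Set R') := by rw [hcz1]; exact hJ'def
  -- the origin point-step law for the sheared label
  obtain ⟨cs, hcs1, -, -, hgens, hnes, hδs, hvps, hwps, hords, -, -, hβs⟩ :=
    exists_prepared_label_pointStep φ k₁ k₀ k₂ hgenz' hdim hgen'' hdim' hψ hJ'def' hJμ hord hnez hδz hwprepz hJμ'
      (hτ' c'' hgen'')
  refine ⟨cs, by rw [hcs1, hc''1, h₁], hgens, hnes, hδs, hvps, hwps, hords, ?_⟩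
  rw [← hβz]; exact hβs

end Literature.AlgebraicGeometry.Resolution

end
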